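import Mathlib
import Literature.Analysis.Fourier.ConstOfFourierSupportZero
import HarnessLib

/-!
# Route EternalPapapetrou · SchwarzschildExteriorModeRigidity — band-limited kernels, I

Helper file for item stmt-FinalStateConjecture-10039 (`SchwarzschildExteriorModeRigidity`).

The Fourier side of the temporal band-limitation. We fix an even real bump `b` (`= 1` on
`[-1, 1]`, supported in `(-2, 2)`), its dilates `b(ξ/ρ)` as Schwartz functions `sbump ρ`, and the
kernels `kerC ρ = 𝓕⁻¹ (sbump ρ) ∈ 𝓢(ℝ, ℂ)`. We prove that `kerC ρ` is real-valued (evenness of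
`b`), record its real part `ker ρ`, the normalisation `∫ ker ρ = 1`, the scaling law
`kerC ρ t = ρ kerC 1 (ρ t)` and the resulting invariance of `∫ |ker ρ|`. [folklore]
-/

set_option linter.dupNamespace false

noncomputable section

namespace Summit.FinalStateConjecture.FinalStateConjecture.Theorems

open MeasureTheory Set Filter Topology Metric FourierTransform Complex
open scoped SchwartzMap ComplexConjugate

namespace EternalPapapetrou.ModeRigidity

/-! ### The even bump on the frequency side -/

/-- The standard bump on `ℝ` (`= 1` on `[-1,1]`, support in `(-2,2)`). [folklore] -/
def β₀ : ContDiffBump (0 : ℝ) := ⟨1, 2, one_pos, one_lt_two⟩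

/-- The symmetrised, dilated bump `rbump ρ ξ = (β₀(ξ/ρ) + β₀(-ξ/ρ))/2`, real-valued.
[folklore] -/
def rbump (ρ ξ : ℝ) : ℝ := (β₀ (ρ⁻¹ * ξ) + β₀ (-(ρ⁻¹ * ξ))) / 2

/-- `rbump ρ` is even. [folklore] -/
theorem rbump_neg (ρ ξ : ℝ) : rbump ρ (-ξ) = rbump ρ ξ := by
  unfold rbump
  rw [mul_neg, neg_neg, add_comm]

/-- `rbump ρ` is smooth. [folklore] -/
theorem contDiff_rbump (ρ : ℝ) {n : ℕ∞} : ContDiff ℝ n (rbump ρ) := by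
  unfold rbump
  have h1 : ContDiff ℝ n fun ξ : ℝ ↦ β₀ (ρ⁻¹ * ξ) :=
    β₀.contDiff.comp (contDiff_const.mul contDiff_id)
  have h2 : ContDiff ℝ n fun ξ : ℝ ↦ β₀ (-(ρ⁻¹ * ξ)) :=
    β₀.contDiff.comp ((contDiff_const.mul contDiff_id).neg)
  exact (h1.add h2).div_const 2

/-- `rbump ρ ξ = 1` for `|ξ| ≤ ρ` (`ρ > 0`). [folklore] -/
theorem rbump_eq_one {ρ ξ : ℝ} (hρ : 0 < ρ) (hξ : |ξ| ≤ ρ) : rbump ρ ξ = 1 := by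
  have hmem : ∀ s : ℝ, |s| ≤ ρ → β₀ (ρ⁻¹ * s) = 1 := by
    intro s hs
    apply β₀.one_of_mem_closedBall
    rw [mem_closedBall, dist_zero_right, Real.norm_eq_abs, abs_mul, abs_of_pos (inv_pos.2 hρ)]
    show ρ⁻¹ * |s| ≤ 1
    rw [inv_mul_le_iff₀ hρ]
    simpa using hs
  unfold rbump
  rw [show -(ρ⁻¹ * ξ) = ρ⁻¹ * (-ξ) by ring, hmem ξ hξ, hmem (-ξ) (by simpa using hξ)]
  norm_num

/-- `rbump ρ ξ = 0` for `2ρ ≤ |ξ|` (`ρ > 0`). [folklore] -/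
theorem rbump_eq_zero {ρ ξ : ℝ} (hρ : 0 < ρ) (hξ : 2 * ρ ≤ |ξ|) : rbump ρ ξ = 0 := by
  have hout : ∀ s : ℝ, 2 * ρ ≤ |s| → β₀ (ρ⁻¹ * s) = 0 := by
    intro s hs
    apply β₀.zero_of_le_dist
    rw [dist_zero_right, Real.norm_eq_abs, abs_mul, abs_of_pos (inv_pos.2 hρ)]
    show (2 : ℝ) ≤ ρ⁻¹ * |s|
    rw [le_inv_mul_iff₀ hρ]
    linarith
  unfold rbump
  rw [show -(ρ⁻¹ * ξ) = ρ⁻¹ * (-ξ) by ring, hout ξ hξ, hout (-ξ) (by simpa using hξ)]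
  norm_num

/-- `0 ≤ rbump ρ ξ ≤ 1`. [folklore] -/
theorem rbump_nonneg_le_one (ρ ξ : ℝ) : 0 ≤ rbump ρ ξ ∧ rbump ρ ξ ≤ 1 := by
  unfold rbump
  constructor
  · have := β₀.nonneg (x := ρ⁻¹ * ξ); have := β₀.nonneg (x := -(ρ⁻¹ * ξ)); positivity
  · have := β₀.le_one (x := ρ⁻¹ * ξ); have := β₀.le_one (x := -(ρ⁻¹ * ξ)); linarith

/-- `rbump ρ` has compact support (`ρ > 0`): it vanishes outside `[-2ρ, 2ρ]`. [folklore] -/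
theorem hasCompactSupport_rbump {ρ : ℝ} (hρ : 0 < ρ) : HasCompactSupport (rbump ρ) := by
  refine HasCompactSupport.of_support_subset_isCompact (isCompact_Icc (a := -(2 * ρ)) (b := 2 * ρ))
    fun ξ hξ ↦ ?_
  by_contra h
  rw [mem_Icc, not_and_or, not_le, not_le] at h
  apply hξ
  apply rbump_eq_zero hρ
  rcases h with h | h
  · rw [abs_of_neg (by linarith)]; linarith
  · rw [abs_of_pos (by linarith)]; linarith

/-- The complex-valued dilated bump `ξ ↦ (rbump ρ ξ : ℂ)` is smooth. [folklore] -/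
theorem contDiff_rbumpC (ρ : ℝ) : ContDiff ℝ ((⊤ : ℕ∞) : WithTop ℕ∞) fun ξ ↦ (rbump ρ ξ : ℂ) :=
  ofRealCLM.contDiff.comp (contDiff_rbump ρ)

/-- … and compactly supported for `ρ > 0`. [folklore] -/
theorem hasCompactSupport_rbumpC {ρ : ℝ} (hρ : 0 < ρ) :
    HasCompactSupport fun ξ ↦ (rbump ρ ξ : ℂ) :=
  (hasCompactSupport_rbump hρ).comp_left ofReal_zero

/-- The dilated even bump as a complex Schwartz function `sbump ρ` (`ρ > 0`). [folklore] -/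
def sbump (ρ : ℝ) (hρ : 0 < ρ) : 𝓢(ℝ, ℂ) :=
  (hasCompactSupport_rbumpC hρ).toSchwartzMap (contDiff_rbumpC ρ)

/-- Values of `sbump`. [folklore] -/
@[simp] theorem sbump_apply (ρ : ℝ) (hρ : 0 < ρ) (ξ : ℝ) : sbump ρ hρ ξ = (rbump ρ ξ : ℂ) := rfl

/-! ### The kernels `kerC ρ = 𝓕⁻¹ (sbump ρ)` and their real parts -/

/-- The band-limited kernel `kerC ρ = 𝓕⁻¹ (b(·/ρ)) ∈ 𝓢(ℝ, ℂ)`. [folklore] -/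
def kerC (ρ : ℝ) (hρ : 0 < ρ) : 𝓢(ℝ, ℂ) := 𝓕⁻ (sbump ρ hρ)

/-- Its Fourier transform is the bump. [folklore] -/
theorem fourier_kerC (ρ : ℝ) (hρ : 0 < ρ) : 𝓕 (kerC ρ hρ) = sbump ρ hρ := by
  simp [kerC]

/-- `kerC` as an integral: `kerC ρ t = ∫ 𝐞(v t) b(v/ρ) dv`. [folklore] -/
theorem kerC_apply (ρ : ℝ) (hρ : 0 < ρ) (t : ℝ) :
    kerC ρ hρ t = ∫ v : ℝ, ((𝐞 (t * v) : Circle) : ℂ) * (rbump ρ v : ℂ) := by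
  rw [kerC, SchwartzMap.fourierInv_coe, Real.fourierInv_eq]
  congr 1

/-- **The kernels are real-valued** (the bump is real and even). [folklore] -/
theorem conj_kerC (ρ : ℝ) (hρ : 0 < ρ) (t : ℝ) : conj (kerC ρ hρ t) = kerC ρ hρ t := by
  rw [kerC_apply, ← integral_conj]
  have h1 : ∀ v : ℝ, conj (((𝐞 (t * v) : Circle) : ℂ) * (rbump ρ v : ℂ)) =
      ((𝐞 (t * (-v)) : Circle) : ℂ) * (rbump ρ (-v) : ℂ) := by
    intro v
    rw [map_mul, conj_ofReal, rbump_neg, ← Circle.coe_inv_eq_conj, ← AddChar.map_neg_eq_inv,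
      mul_neg]
  simp_rw [h1]
  exact integral_neg_eq_self (fun v : ℝ ↦ ((𝐞 (t * v) : Circle) : ℂ) * (rbump ρ v : ℂ)) volume

/-- The imaginary part of `kerC` vanishes. [folklore] -/
theorem kerC_im (ρ : ℝ) (hρ : 0 < ρ) (t : ℝ) : (kerC ρ hρ t).im = 0 :=
  conj_eq_iff_im.1 (conj_kerC ρ hρ t)

/-- The real kernel `ker ρ t = Re (kerC ρ t)`. [folklore] -/
def ker (ρ : ℝ) (hρ : 0 < ρ) (t : ℝ) : ℝ := (kerC ρ hρ t).re

/-- `kerC ρ t = (ker ρ t : ℂ)`. [folklore] -/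
theorem kerC_eq_ofReal (ρ : ℝ) (hρ : 0 < ρ) (t : ℝ) : kerC ρ hρ t = (ker ρ hρ t : ℂ) := by
  apply Complex.ext
  · simp [ker]
  · simp [kerC_im]

/-- `ker ρ` is continuous. [folklore] -/
theorem continuous_ker (ρ : ℝ) (hρ : 0 < ρ) : Continuous (ker ρ hρ) :=
  continuous_re.comp (kerC ρ hρ).continuous

/-- `ker ρ` is integrable. [folklore] -/
theorem integrable_ker (ρ : ℝ) (hρ : 0 < ρ) : Integrable (ker ρ hρ) :=
  (kerC ρ hρ).integrable.re

/-- `ker ρ` is bounded. [folklore] -/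
theorem exists_bound_ker (ρ : ℝ) (hρ : 0 < ρ) : ∃ B, ∀ t, ‖ker ρ hρ t‖ ≤ B := by
  obtain ⟨B, hB⟩ : ∃ B, ∀ t, ‖kerC ρ hρ t‖ ≤ B :=
    ⟨SchwartzMap.seminorm ℝ 0 0 (kerC ρ hρ), fun t ↦ SchwartzMap.norm_le_seminorm ℝ _ t⟩
  exact ⟨B, fun t ↦ (RCLike.norm_re_le_norm (kerC ρ hρ t)).trans (hB t)⟩

/-- **Normalisation**: `∫ ker ρ = 1` (`= b(0)`). [folklore] -/
theorem integral_ker (ρ : ℝ) (hρ : 0 < ρ) : ∫ t, ker ρ hρ t = 1 := by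
  have h1 : ∫ t, kerC ρ hρ t = 1 := by
    have h2 : (𝓕 (kerC ρ hρ) : 𝓢(ℝ, ℂ)) 0 = ∫ t, kerC ρ hρ t := by
      rw [SchwartzMap.fourier_coe, Real.fourier_real_eq]
      simp
    rw [← h2, fourier_kerC, sbump_apply, rbump_eq_one hρ (by simpa using hρ.le), ofReal_one]
  have h3 : ∫ t, ker ρ hρ t = RCLike.re (∫ t, kerC ρ hρ t) := by
    rw [← integral_re (kerC ρ hρ).integrable]
    rfl
  rw [h3, h1]
  simp

/-- **Scaling**: `kerC ρ t = ρ · kerC 1 (ρ t)`. [folklore] -/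
theorem kerC_scaling (ρ : ℝ) (hρ : 0 < ρ) (t : ℝ) :
    kerC ρ hρ t = (ρ : ℂ) * kerC 1 one_pos (ρ * t) := by
  have hc : (ρ⁻¹ : ℝ) ≠ 0 := inv_ne_zero hρ.ne'
  have hfun : ((sbump ρ hρ : 𝓢(ℝ, ℂ)) : ℝ → ℂ) = fun ξ ↦ (sbump 1 one_pos : ℝ → ℂ) (ρ⁻¹ • ξ) := by
    funext ξ
    simp [rbump, smul_eq_mul]
  rw [kerC, SchwartzMap.fourierInv_coe, hfun,
    Literature.Analysis.Fourier.fourierInv_comp_smul ((sbump 1 one_pos : 𝓢(ℝ, ℂ)) : ℝ → ℂ) hc]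
  simp only [Module.finrank_self, pow_one, inv_inv, abs_of_pos hρ, smul_eq_mul, kerC,
    SchwartzMap.fourierInv_coe, real_smul]

/-- Real form of the scaling law: `ker ρ t = ρ · ker 1 (ρ t)`. [folklore] -/
theorem ker_scaling (ρ : ℝ) (hρ : 0 < ρ) (t : ℝ) :
    ker ρ hρ t = ρ * ker 1 one_pos (ρ * t) := by
  have := kerC_scaling ρ hρ t
  rw [kerC_eq_ofReal, kerC_eq_ofReal, ← ofReal_mul, ofReal_inj] at this
  exact this

/-- The `L¹` norm of `ker ρ` does not depend on `ρ`. [folklore] -/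
theorem integral_norm_ker (ρ : ℝ) (hρ : 0 < ρ) :
    ∫ t, ‖ker ρ hρ t‖ = ∫ t, ‖ker 1 one_pos t‖ := by
  have h1 : (fun t ↦ ‖ker ρ hρ t‖) = fun t ↦ ρ * ‖ker 1 one_pos (ρ * t)‖ := by
    funext t
    rw [ker_scaling ρ hρ t, norm_mul, Real.norm_eq_abs, abs_of_pos hρ]
  rw [h1, integral_const_mul, Measure.integral_comp_mul_left (fun t ↦ ‖ker 1 one_pos t‖) ρ]
  rw [abs_of_pos (inv_pos.2 hρ), smul_eq_mul, ← mul_assoc, mul_inv_cancel₀ hρ.ne', one_mul]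

end EternalPapapetrou.ModeRigidity

end Summit.FinalStateConjecture.FinalStateConjecture.Theorems
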